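import Mathlib
import Summits.NavierStokesRegularity.NavierStokesRegularity.Theorems.FilamentSkeletonRssKelvinGateFreeGateSharp
import Summits.NavierStokesRegularity.NavierStokesRegularity.Theorems.FilamentSkeletonRssKelvinGateFreeGateSharpLinear
import Summits.NavierStokesRegularity.NavierStokesRegularity.Theorems.FilamentSkeletonRssKelvinGateSharpScaleMaps

/-!
# Route `FilamentSkeletonRss` · crux `TransverseReduction1A` (stmt-27414; successor of the aside `TransverseReductionRJ`,
# stmt-21221) — line `kelvin_gate`: the SHARP SCALES `X♯_a`, `Y♯_a` as predicates, their algebra, and the free gate restated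

Definitions + theorems (`--as helper`; the two `def`s are route-posited vocabulary in the sense of CONVENTIONS §1, like
`XBound`/`YBound` of `…KelvinGateDefs`).  HONEST FRAMING: analysis bookkeeping for a HYPOTHETICAL filament-type rotating
self-similar blow-up route; nothing here bears on Navier–Stokes regularity; no stub is proved here.

The coarse scales `XBound`/`YBound` of the registered line carry the weight `⟨y⟩` resp. `⟨y⟩²` on every derivative; the free
Kelvin gate does NOT close in them (memo FREE-GATE-PRESSURE-21221-g7 §3: Calderón–Zygmund-critical).  It closes in the SHARP scales
(design memo SHARP-WEIGHTS-DESIGN-21221-g7; theorem `free_kelvin_gate_sharp`), which this file names, for an internal weight `a`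
(`1 < a < 2` in use; `a = 3/2` symmetric):

* `XSharp a W R` — `W ∈ C²`, `⟨y⟩‖W‖ ≤ R`, `⟨y⟩^a‖DW‖ ≤ R`, `⟨y⟩^a‖D²W‖ ≤ R`;
* `YSharp a F R` — `F ∈ C¹`, `⟨y⟩^{a+1}‖F‖ ≤ R`, `⟨y⟩^{a+1}‖DF‖ ≤ R`;
* algebra: `nonneg`, `mono`, `zero`, `add`, `smul`, `neg`, `sub`, unweighted bounds;
* `XSharp.ySharp_fderiv_apply` — `X♯_a × X♯_a → Y♯_a` for `DW[W′]` (radius `2RR′`, from `sharp_bilinear`);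
* `XSharp.ySharp_perturbation` — `X♯_a → Y♯_a` for `DW[U] + DU[W]` at a decaying `C²` base (radius `4MR`, from `sharp_perturbation`);
* `free_kelvin_gate_ySharp` — **the free gate in predicate form**: `∃ C(a) ∀ α F R, YSharp a F R →` the explicit pair `(W[F], Q[F])` has
  `XSharp a W (C R)`, `div W = 0`, `Q ∈ C¹`, `|Q| ≤ CR`, `⟨y⟩^a‖∇Q‖ ≤ CR`, `𝓛_(α,0)W + ∇Q = F`; and `sharpGate_add_smul` — linearity.
-/

set_option linter.dupNamespace false

noncomputable section

namespace Summit.NavierStokesRegularity.NavierStokesRegularity.Theorems.KelvinGate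

open Set Function Filter Topology InnerProductSpace MeasureTheory Real Metric
open Literature.Analysis.FluidPDE Literature.Analysis.FluidPDE.NewtonPotentialHolder Literature.Analysis.UnboundedOperators
open scoped Laplacian RealInnerProductSpace ContDiff Topology ENNReal BigOperators

/-! ## The sharp scales -/

/-- **Sharp X-scale of weight `a`** (velocity-type fields): `W ∈ C²` with `⟨y⟩‖W‖ ≤ R`, `⟨y⟩^a‖DW‖ ≤ R`, `⟨y⟩^a‖D²W‖ ≤ R`
pointwise (`⟨y⟩ = 1 + |y|`; the value weight `1` is the sharp Leray tail, the derivative weight `a ∈ (1,2)` is what the free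
resolvent delivers on weight-`(a+1)` data).  Sup-type sizes as pointwise inequalities with an explicit radius. -/
def XSharp (a : ℝ) (W : EuclideanSpace ℝ (Fin 3) → EuclideanSpace ℝ (Fin 3)) (R : ℝ) : Prop :=
  ContDiff ℝ 2 W ∧ ∀ y, (1 + ‖y‖) * ‖W y‖ ≤ R ∧ (1 + ‖y‖) ^ a * ‖fderiv ℝ W y‖ ≤ R ∧
    (1 + ‖y‖) ^ a * ‖fderiv ℝ (fderiv ℝ W) y‖ ≤ R

/-- **Sharp Y-scale of weight `a`** (forcing-type fields): `F ∈ C¹` with `⟨y⟩^{a+1}‖F‖ ≤ R`, `⟨y⟩^{a+1}‖DF‖ ≤ R` pointwise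
(`⟨y⟩^{-(a+1)}` is the decay of `DW[W′]` for `W, W′` in the sharp X-scale, since `2a ≥ a + 1`). -/
def YSharp (a : ℝ) (F : EuclideanSpace ℝ (Fin 3) → EuclideanSpace ℝ (Fin 3)) (R : ℝ) : Prop :=
  ContDiff ℝ 1 F ∧ ∀ y, (1 + ‖y‖) ^ (a + 1) * ‖F y‖ ≤ R ∧ (1 + ‖y‖) ^ (a + 1) * ‖fderiv ℝ F y‖ ≤ R

section Algebra

variable {a : ℝ} {W W' F F₁ F₂ : EuclideanSpace ℝ (Fin 3) → EuclideanSpace ℝ (Fin 3)} {R R' R₁ R₂ : ℝ}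

/-- The radius of a sharp X-bound is nonnegative. -/
theorem XSharp.nonneg (h : XSharp a W R) : 0 ≤ R := le_trans (by positivity) (h.2 0).1

/-- Monotonicity of the sharp X-scale in the radius. -/
theorem XSharp.mono (h : XSharp a W R) (hR : R ≤ R') : XSharp a W R' :=
  ⟨h.1, fun y => ⟨(h.2 y).1.trans hR, (h.2 y).2.1.trans hR, (h.2 y).2.2.trans hR⟩⟩

/-- Unweighted consequences of a sharp X-bound: `‖W y‖ ≤ R`, `‖DW y‖ ≤ R` (`0 ≤ a`). -/
theorem XSharp.norm_le' (h : XSharp a W R) (ha : 0 ≤ a) (y : EuclideanSpace ℝ (Fin 3)) : ‖W y‖ ≤ R ∧ ‖fderiv ℝ W y‖ ≤ R := by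
  have hw1 : (1:ℝ) ≤ 1 + ‖y‖ := by linarith [norm_nonneg y]
  have hwa : (1:ℝ) ≤ (1 + ‖y‖) ^ a := Real.one_le_rpow hw1 ha
  exact ⟨(le_mul_of_one_le_left (norm_nonneg _) hw1).trans (h.2 y).1,
    (le_mul_of_one_le_left (norm_nonneg _) hwa).trans (h.2 y).2.1⟩

/-- The zero field is in the sharp X-scale with radius `0`. -/
theorem xSharp_zero : XSharp a (fun _ : EuclideanSpace ℝ (Fin 3) => (0 : EuclideanSpace ℝ (Fin 3))) 0 := by
  have h1 : fderiv ℝ (fun _ : EuclideanSpace ℝ (Fin 3) => (0 : EuclideanSpace ℝ (Fin 3))) =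
      fun _ => (0 : EuclideanSpace ℝ (Fin 3) →L[ℝ] EuclideanSpace ℝ (Fin 3)) := by
    funext z; exact fderiv_const_apply 0
  refine ⟨contDiff_const, fun y => ⟨by simp, ?_, ?_⟩⟩
  · rw [h1]; simp
  · rw [h1, fderiv_const_apply, ContinuousLinearMap.opNorm_zero, mul_zero]

/-- The radius of a sharp Y-bound is nonnegative. -/
theorem YSharp.nonneg (h : YSharp a F R) : 0 ≤ R := le_trans (by positivity) (h.2 0).1

/-- Monotonicity of the sharp Y-scale in the radius. -/
theorem YSharp.mono (h : YSharp a F R) (hR : R ≤ R') : YSharp a F R' :=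
  ⟨h.1, fun y => ⟨(h.2 y).1.trans hR, (h.2 y).2.trans hR⟩⟩

/-- Pointwise decay from a sharp Y-bound: `‖F y‖ ≤ R / (1+|y|)^{a+1}`. -/
theorem YSharp.norm_le (h : YSharp a F R) (y : EuclideanSpace ℝ (Fin 3)) : ‖F y‖ ≤ R / (1 + ‖y‖) ^ (a + 1) := by
  rw [le_div_iff₀ (by positivity), mul_comm]; exact (h.2 y).1

/-- Unweighted consequences of a sharp Y-bound (`-1 ≤ a`): `‖F y‖ ≤ R`, `‖DF y‖ ≤ R`. -/
theorem YSharp.norm_le' (h : YSharp a F R) (ha : -1 ≤ a) (y : EuclideanSpace ℝ (Fin 3)) : ‖F y‖ ≤ R ∧ ‖fderiv ℝ F y‖ ≤ R := by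
  have hw : (1:ℝ) ≤ (1 + ‖y‖) ^ (a + 1) := Real.one_le_rpow (by linarith [norm_nonneg y]) (by linarith)
  exact ⟨(le_mul_of_one_le_left (norm_nonneg _) hw).trans (h.2 y).1, (le_mul_of_one_le_left (norm_nonneg _) hw).trans (h.2 y).2⟩

/-- The zero field is in the sharp Y-scale with radius `0`. -/
theorem ySharp_zero : YSharp a (fun _ : EuclideanSpace ℝ (Fin 3) => (0 : EuclideanSpace ℝ (Fin 3))) 0 := by
  refine ⟨contDiff_const, fun y => ?_⟩
  simp

/-- **The sharp Y-scale is closed under addition.** -/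
theorem YSharp.add (h₁ : YSharp a F₁ R₁) (h₂ : YSharp a F₂ R₂) : YSharp a (fun y => F₁ y + F₂ y) (R₁ + R₂) := by
  refine ⟨h₁.1.add h₂.1, fun y => ⟨?_, ?_⟩⟩
  · calc (1 + ‖y‖) ^ (a + 1) * ‖F₁ y + F₂ y‖ ≤ (1 + ‖y‖) ^ (a + 1) * (‖F₁ y‖ + ‖F₂ y‖) :=
          mul_le_mul_of_nonneg_left (norm_add_le _ _) (by positivity)
      _ ≤ R₁ + R₂ := by rw [mul_add]; exact add_le_add (h₁.2 y).1 (h₂.2 y).1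
  · rw [fderiv_fun_add (h₁.1.differentiable (by norm_num) y) (h₂.1.differentiable (by norm_num) y)]
    calc (1 + ‖y‖) ^ (a + 1) * ‖fderiv ℝ F₁ y + fderiv ℝ F₂ y‖
          ≤ (1 + ‖y‖) ^ (a + 1) * (‖fderiv ℝ F₁ y‖ + ‖fderiv ℝ F₂ y‖) :=
          mul_le_mul_of_nonneg_left (norm_add_le _ _) (by positivity)
      _ ≤ R₁ + R₂ := by rw [mul_add]; exact add_le_add (h₁.2 y).2 (h₂.2 y).2

/-- **The sharp Y-scale is closed under scalar multiplication** (radius `|c| R`). -/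
theorem YSharp.smul (h : YSharp a F R) (c : ℝ) : YSharp a (fun y => c • F y) (|c| * R) := by
  refine ⟨h.1.const_smul c, fun y => ⟨?_, ?_⟩⟩
  · rw [norm_smul, Real.norm_eq_abs]
    calc (1 + ‖y‖) ^ (a + 1) * (|c| * ‖F y‖) = |c| * ((1 + ‖y‖) ^ (a + 1) * ‖F y‖) := by ring
      _ ≤ |c| * R := mul_le_mul_of_nonneg_left (h.2 y).1 (abs_nonneg c)
  · rw [fderiv_fun_const_smul (h.1.differentiable (by norm_num) y), norm_smul, Real.norm_eq_abs]
    calc (1 + ‖y‖) ^ (a + 1) * (|c| * ‖fderiv ℝ F y‖) = |c| * ((1 + ‖y‖) ^ (a + 1) * ‖fderiv ℝ F y‖) := by ring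
      _ ≤ |c| * R := mul_le_mul_of_nonneg_left (h.2 y).2 (abs_nonneg c)

/-- Negation in the sharp Y-scale. -/
theorem YSharp.neg (h : YSharp a F R) : YSharp a (fun y => -F y) R := by
  have h1 := h.smul (-1)
  simp only [neg_smul, one_smul, abs_neg, abs_one, one_mul] at h1
  exact h1

/-- Subtraction in the sharp Y-scale. -/
theorem YSharp.sub (h₁ : YSharp a F₁ R₁) (h₂ : YSharp a F₂ R₂) : YSharp a (fun y => F₁ y - F₂ y) (R₁ + R₂) := by
  have h := h₁.add h₂.neg
  simp only [← sub_eq_add_neg] at h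
  exact h

/-! ## The profile operator's remaining terms in the sharp scales -/

/-- **`DW[W′] : X♯_a × X♯_a → Y♯_a`**, radius `2RR′` (`1 ≤ a`; `…SharpScaleMaps.sharp_bilinear`). -/
theorem XSharp.ySharp_fderiv_apply (ha : 1 ≤ a) (hW : XSharp a W R) (hW' : XSharp a W' R') :
    YSharp a (fun y => fderiv ℝ W y (W' y)) (2 * R * R') := by
  obtain ⟨hc, hv, hd⟩ := sharp_bilinear ha hW.1 (hW'.1.of_le (by norm_num)) (fun y => (hW.2 y).2.1) (fun y => (hW.2 y).2.2)
    (fun y => (hW'.2 y).1) (fun y => (hW'.2 y).2.1)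
  have hRR : 0 ≤ R * R' := mul_nonneg hW.nonneg hW'.nonneg
  exact ⟨hc, fun y => ⟨(hv y).trans (by linarith), hd y⟩⟩

/-- **`DW[U] + DU[W] : X♯_a → Y♯_a`** at a `C²` base with `⟨y⟩‖U‖, ⟨y⟩²‖DU‖, ⟨y⟩³‖D²U‖ ≤ M`, radius `4MR` (`a ≤ 2`). -/
theorem XSharp.ySharp_perturbation (ha : a ≤ 2) {U : EuclideanSpace ℝ (Fin 3) → EuclideanSpace ℝ (Fin 3)} {M : ℝ}
    (hU : ContDiff ℝ 2 U) (hU0 : ∀ y, (1 + ‖y‖) * ‖U y‖ ≤ M) (hU1 : ∀ y, (1 + ‖y‖) ^ 2 * ‖fderiv ℝ U y‖ ≤ M)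
    (hU2 : ∀ y, (1 + ‖y‖) ^ 3 * ‖fderiv ℝ (fderiv ℝ U) y‖ ≤ M) (hW : XSharp a W R) :
    YSharp a (fun y => fderiv ℝ W y (U y) + fderiv ℝ U y (W y)) (4 * M * R) := by
  obtain ⟨hc, hv, hd⟩ := sharp_perturbation ha hU hU0 hU1 hU2 hW.1 (fun y => (hW.2 y).1) (fun y => (hW.2 y).2.1)
    (fun y => (hW.2 y).2.2)
  have hMR : 0 ≤ M * R := mul_nonneg (le_trans (by positivity) (hU0 0)) hW.nonneg
  exact ⟨hc, fun y => ⟨(hv y).trans (by linarith), hd y⟩⟩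

end Algebra

/-! ## The free Kelvin gate in predicate form -/

/-- **THE FREE KELVIN GATE, predicate form.**  For `1 < a < 2` there is `C ≥ 0` such that for every rate `α` and every
`YSharp a F R` the explicit pair `Q[F] = Σⱼ T_{eⱼ}Fⱼ`, `W[F]` = free OU resolvent of `F − ∇Q[F]`, satisfies `XSharp a W[F] (C R)`,
`div W[F] = 0`, `Q[F] ∈ C¹`, `|Q[F]| ≤ C R`, `⟨y⟩^a‖∇Q[F]‖ ≤ C R` and `𝓛_(α,0) W[F] + ∇Q[F] = F`. -/
theorem free_kelvin_gate_ySharp {a : ℝ} (ha1 : 1 < a) (ha2 : a < 2) :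
    ∃ C : ℝ, 0 ≤ C ∧ ∀ (α : ℝ) (F : EuclideanSpace ℝ (Fin 3) → EuclideanSpace ℝ (Fin 3)) (R : ℝ), YSharp a F R →
      XSharp a (fun y => ∫ s in Ioi (0:ℝ), (Real.exp (-(s / 2)) • rotZL (-(α * s)))
          (heatExtension (fun x => F x - gradient (fun x => ∑ j : Fin 3,
            newtonGradPotential (EuclideanSpace.single j (1:ℝ)) (fun y => F y j) x) x)
            (1 - Real.exp (-s)) ((Real.exp (-(s / 2)) • rotZL (α * s)) y))) (C * R) ∧
      VectorCalculus.IsDivFree (fun y => ∫ s in Ioi (0:ℝ), (Real.exp (-(s / 2)) • rotZL (-(α * s)))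
          (heatExtension (fun x => F x - gradient (fun x => ∑ j : Fin 3,
            newtonGradPotential (EuclideanSpace.single j (1:ℝ)) (fun y => F y j) x) x)
            (1 - Real.exp (-s)) ((Real.exp (-(s / 2)) • rotZL (α * s)) y))) ∧
      ContDiff ℝ 1 (fun x => ∑ j : Fin 3, newtonGradPotential (EuclideanSpace.single j (1:ℝ)) (fun y => F y j) x) ∧
      (∀ x, |∑ j : Fin 3, newtonGradPotential (EuclideanSpace.single j (1:ℝ)) (fun y => F y j) x| ≤ C * R) ∧
      (∀ x, (1 + ‖x‖) ^ a * ‖gradient (fun x => ∑ j : Fin 3,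
        newtonGradPotential (EuclideanSpace.single j (1:ℝ)) (fun y => F y j) x) x‖ ≤ C * R) ∧
      (∀ y, lerayLin α (fun _ => 0) (fun y => ∫ s in Ioi (0:ℝ), (Real.exp (-(s / 2)) • rotZL (-(α * s)))
          (heatExtension (fun x => F x - gradient (fun x => ∑ j : Fin 3,
            newtonGradPotential (EuclideanSpace.single j (1:ℝ)) (fun y => F y j) x) x)
            (1 - Real.exp (-s)) ((Real.exp (-(s / 2)) • rotZL (α * s)) y))) y +
        gradient (fun x => ∑ j : Fin 3, newtonGradPotential (EuclideanSpace.single j (1:ℝ)) (fun y => F y j) x) y = F y) := by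
  obtain ⟨C, hC0, h⟩ := free_kelvin_gate_sharp ha1 ha2
  refine ⟨C, hC0, fun α F R hF => ?_⟩
  obtain ⟨hW2, hdiv, hW0, hW1, hW2b, hQ1, hQb, hDQ, heq⟩ := h α F R hF.1 (fun y => (hF.2 y).1) (fun y => (hF.2 y).2)
  exact ⟨⟨hW2, fun y => ⟨hW0 y, hW1 y, hW2b y⟩⟩, hdiv, hQ1, hQb, hDQ, heq⟩

/-- **Linearity of the free gate on the sharp Y-scale**: for `YSharp a F R`, `YSharp a F′ R′` (`1 ≤ a`), every rate `α` and
every `t`, `W[F + tF′] = W[F] + tW[F′]` pointwise (`…FreeGateSharpLinear.free_kelvin_gate_sharp_linear`). -/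
theorem sharpGate_add_smul {a : ℝ} (ha : 1 ≤ a) {F F' : EuclideanSpace ℝ (Fin 3) → EuclideanSpace ℝ (Fin 3)} {R R' : ℝ}
    (hF : YSharp a F R) (hF' : YSharp a F' R') (t α : ℝ) (y : EuclideanSpace ℝ (Fin 3)) :
    (∫ s in Ioi (0:ℝ), (Real.exp (-(s / 2)) • rotZL (-(α * s)))
        (heatExtension (fun x => (F x + t • F' x) - gradient (fun x => ∑ j : Fin 3,
          newtonGradPotential (EuclideanSpace.single j (1:ℝ)) (fun y => (F y + t • F' y) j) x) x)
          (1 - Real.exp (-s)) ((Real.exp (-(s / 2)) • rotZL (α * s)) y))) =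
      (∫ s in Ioi (0:ℝ), (Real.exp (-(s / 2)) • rotZL (-(α * s)))
        (heatExtension (fun x => F x - gradient (fun x => ∑ j : Fin 3,
          newtonGradPotential (EuclideanSpace.single j (1:ℝ)) (fun y => F y j) x) x)
          (1 - Real.exp (-s)) ((Real.exp (-(s / 2)) • rotZL (α * s)) y))) +
      t • (∫ s in Ioi (0:ℝ), (Real.exp (-(s / 2)) • rotZL (-(α * s)))
        (heatExtension (fun x => F' x - gradient (fun x => ∑ j : Fin 3,
          newtonGradPotential (EuclideanSpace.single j (1:ℝ)) (fun y => F' y j) x) x)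
          (1 - Real.exp (-s)) ((Real.exp (-(s / 2)) • rotZL (α * s)) y))) :=
  (free_kelvin_gate_sharp_linear hF.1 hF'.1 (sq_weight_mul_norm_le_of_rpow_weight ha (fun y => (hF.2 y).1))
    (sq_weight_mul_norm_le_of_rpow_weight ha (fun y => (hF.2 y).2))
    (sq_weight_mul_norm_le_of_rpow_weight ha (fun y => (hF'.2 y).1))
    (sq_weight_mul_norm_le_of_rpow_weight ha (fun y => (hF'.2 y).2)) t α y).1

end Summit.NavierStokesRegularity.NavierStokesRegularity.Theorems.KelvinGate

end
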